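import Mathlib
import Summits.ValiantsHypothesis.ValiantsHypothesis.Theorems.DivisionGapDefs
import Summits.ValiantsHypothesis.ValiantsHypothesis.Theorems.PerDivisionHard.Negative.PlainBridge
import Literature.Computability.AlgebraicComplexity.PermanentIrreducible
import Summits.ValiantsHypothesis.ValiantsHypothesis.Theorems.DivisionGapPerCofactorDegreeReductionStubIsolatedStrip
import Summits.ValiantsHypothesis.ValiantsHypothesis.Theorems.DivisionGapPerCofactorDegreeReductionStubDominantSelfIsolation
import Summits.ValiantsHypothesis.ValiantsHypothesis.Theorems.DivisionGapPerCofactorDegreeReductionStubDominantHoleIsolation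
import Summits.ValiantsHypothesis.ValiantsHypothesis.Theorems.DivisionGapPerCofactorDegreeReductionStubBlockProjection
import Summits.ValiantsHypothesis.ValiantsHypothesis.Theorems.DivisionGapPerCofactorDegreeReductionStubTwoFactorHole
import Summits.ValiantsHypothesis.ValiantsHypothesis.Theorems.DivisionGapPerCofactorDegreeReductionStubRegularHole

/-!
# `DivisionGap.PerCofactorDegreeReduction` (stmt-ValiantsHypothesis-15046), line `Sketch_ideator4`:
the DOMINANT-MONOMIAL RUNGS (lead c10; registered stubs `stub_dominantHoleRung`,
`stub_dominantSelfRung`, `stub_twoFactorClassRung`, `stub_twoFactorClassHard`, `stub_regularClassRung`)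

A monomial `u` of the cofactor `h ∈ ℝ≥0[x_ij]` is DOMINANT if `v e ≤ u e` for every monomial `v` of `h`
and every cell `e ∈ supp u` (it attains the individual degree `deg_e h` on its support: every monomial
of a multilinear `h`; `N • u₀` inside `g^N` for `g` multilinear; every monomial with entries `N` when
all entries of `h` are `≤ N`).  Dominant monomials are isolated for free —

* in their own support when all monomials of `h` have the same total degree
  (`DominantSelfIsolation.stub_dominantSelfIsolation`, J), and
* in `supp u ∪ Vr × Vc` for any block on which `u` vanishes, when `h` is torus-homogeneous
  (`DominantHoleIsolation.stub_dominantHoleIsolation`, K) —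

so the isolated strip (`IsolatedStrip.stub_isolatedStrip`, F1: member descent + unscaling +
Jukna–Seiwert–Sergeev contraction) bounds the face permanent of the host by
`((n+2)(L⁺(per_n · h)+3))^κ`, and a matching of the complementary lines inside the host plus the full
block projects that face permanent onto `per_m` (`BlockProjection.stub_blockProjection`, L).  With
the placements M (`TwoFactorHole.stub_twoFactorHole`: an `⌊n/3⌋`-hole on any Hamiltonian 2-factor)
and N (`RegularHole.stub_regularHole`: a circulant `D`-regular `0/1` matrix with an `m`-hole,
`D + 3m ≤ n`) this gives:

* `stub_twoFactorClassRung` / `stub_twoFactorClassHard`: every torus-homogeneous `h` with entries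
  `≤ N` through a scaled Hamiltonian 2-factor `N • (μ_π₀ + μ_ρ₀)` has
  `L⁺(per_{⌊n/3⌋}) ≤ ((n+2)(L⁺(per_n·h)+3))^k`, hence (Jerrum–Snir)
  `⌊n/3⌋ (2^{⌊n/3⌋-1} - 1) ≤ 2 ((n+2)(L⁺(per_n·h)+3))^k` — no hypothesis on the other monomials
  (compare `DerSumsHard.stub_derSumsHard`, which needs all monomials to be pair sums and gives `2^{Ω(√n)}`);
* `stub_regularClassRung`: every torus-homogeneous `h` with entries `≤ N` containing `N • u₀` for all
  `D`-regular `0/1` matrices `u₀` (`2 ≤ D`; e.g. the `N`-th power of the complete `D`-regular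
  multilinear class) has `L⁺(per_m) ≤ ((n+2)(L⁺(per_n·h)+3))^k` for `D + 3m ≤ n`.

No definitions in this file. [folklore]
-/

noncomputable section

-- `Summit.ValiantsHypothesis.ValiantsHypothesis.…` is the tree's mandated single-conjunct layout
-- (Sub = Summit), so the duplicated namespace component is intended.
set_option linter.dupNamespace false

open MvPolynomial Literature.Computability.AlgebraicComplexity
open Summit.ValiantsHypothesis.ValiantsHypothesis.Theorems.DivisionGapPerDivisionHard (facePer)
open Summit.ValiantsHypothesis.ValiantsHypothesis.Theorems.DivisionGap.PerCofactorDegreeReduction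
open scoped NNReal

namespace Summit.ValiantsHypothesis.ValiantsHypothesis.Theorems.DivisionGap.PerCofactorDegreeReduction.DominantRungs

/-- **Dominant hole rung (glue: K + F1 + L).**  A torus-homogeneous `h` with a dominant monomial
`u` vanishing on an `m × m` block whose complementary lines are matched inside `supp u` forces
`L⁺(per_m) ≤ ((n+2)(L⁺(per_n · h)+3))^k`. [folklore] -/
theorem stub_dominantHoleRung :
    ∃ k : ℕ, ∀ (n m : ℕ) (h : MvPolynomial (Fin n × Fin n) ℝ≥0) (u : (Fin n × Fin n) →₀ ℕ)
      (er ec : Fin m → Fin n) (M₀ : Fin n → Fin n),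
      u ∈ h.support →
      (∃ τ : (Fin n →₀ ℕ) × (Fin n →₀ ℕ),
        ∀ v ∈ h.support, (Finsupp.mapDomain Prod.fst v, Finsupp.mapDomain Prod.snd v) = τ) →
      (∀ v ∈ h.support, ∀ e ∈ u.support, v e ≤ u e) →
      Function.Injective er → Function.Injective ec →
      (∀ a b, u (er a, ec b) = 0) →
      (∀ j, (∀ b, ec b ≠ j) → (M₀ j, j) ∈ u.support ∧ ∀ a, er a ≠ M₀ j) →
      (∀ j j', (∀ b, ec b ≠ j) → (∀ b, ec b ≠ j') → M₀ j = M₀ j' → j = j') →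
      complexity (perPoly (Fin m) ℝ≥0) ≤
        ((n + 2) * (complexity (perPoly (Fin n) ℝ≥0 * h) + 3)) ^ k := by
  classical
  obtain ⟨k, hk⟩ := IsolatedStrip.stub_isolatedStrip
  refine ⟨k, fun n m h u er ec M₀ hu hτ hdom her hec hblock hM₀ hinj => ?_⟩
  set Vr : Finset (Fin n) := Finset.univ.image er with hVr
  set Vc : Finset (Fin n) := Finset.univ.image ec with hVc
  set G : Finset (Fin n × Fin n) := u.support ∪ Vr ×ˢ Vc with hG
  -- the block carries no cell of `u`
  have hhole : ∀ e ∈ u.support, e.1 ∈ Vr → e.2 ∉ Vc := by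
    rintro ⟨r, c⟩ he hr hc
    obtain ⟨a, -, rfl⟩ := Finset.mem_image.1 hr
    obtain ⟨b, -, rfl⟩ := Finset.mem_image.1 hc
    exact (Finsupp.mem_support_iff.1 he) (hblock a b)
  have hiso : ∀ v ∈ h.support, v.support ⊆ G → v = u :=
    DominantHoleIsolation.stub_dominantHoleIsolation n h u Vr Vc hu hτ hdom hhole
  have hF1 := hk n h u G hu (Finset.subset_union_left) hiso
  refine le_trans ?_ hF1
  refine BlockProjection.stub_blockProjection n m G er ec M₀ her hec (fun a b => ?_) (fun j hj => ?_) hinj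
  · exact Finset.mem_union_right _ (Finset.mem_product.2
      ⟨Finset.mem_image_of_mem _ (Finset.mem_univ a), Finset.mem_image_of_mem _ (Finset.mem_univ b)⟩)
  · exact ⟨Finset.mem_union_left _ (hM₀ j hj).1, (hM₀ j hj).2⟩

/-- **Dominant self rung (glue: J + F1 + L).**  A homogeneous `h` (all monomials of the degree of
`u`) with a dominant monomial `u` whose support contains a full `m × m` block and a matching of the
complementary lines forces `L⁺(per_m) ≤ ((n+2)(L⁺(per_n · h)+3))^k`. [folklore] -/
theorem stub_dominantSelfRung :
    ∃ k : ℕ, ∀ (n m : ℕ) (h : MvPolynomial (Fin n × Fin n) ℝ≥0) (u : (Fin n × Fin n) →₀ ℕ)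
      (er ec : Fin m → Fin n) (M₀ : Fin n → Fin n),
      u ∈ h.support →
      (∀ v ∈ h.support, v.degree = u.degree) →
      (∀ v ∈ h.support, ∀ e ∈ u.support, v e ≤ u e) →
      Function.Injective er → Function.Injective ec →
      (∀ a b, (er a, ec b) ∈ u.support) →
      (∀ j, (∀ b, ec b ≠ j) → (M₀ j, j) ∈ u.support ∧ ∀ a, er a ≠ M₀ j) →
      (∀ j j', (∀ b, ec b ≠ j) → (∀ b, ec b ≠ j') → M₀ j = M₀ j' → j = j') →
      complexity (perPoly (Fin m) ℝ≥0) ≤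
        ((n + 2) * (complexity (perPoly (Fin n) ℝ≥0 * h) + 3)) ^ k := by
  classical
  obtain ⟨k, hk⟩ := IsolatedStrip.stub_isolatedStrip
  refine ⟨k, fun n m h u er ec M₀ hu hdeg hdom her hec hblock hM₀ hinj => ?_⟩
  have hiso : ∀ v ∈ h.support, v.support ⊆ u.support → v = u :=
    DominantSelfIsolation.stub_dominantSelfIsolation n h u hu hdeg hdom
  exact (BlockProjection.stub_blockProjection n m u.support er ec M₀ her hec hblock hM₀ hinj).trans
    (hk n h u u.support hu subset_rfl hiso)

/-- A cell of a scaled pair sum `N • (μ_π₀ + μ_ρ₀)` carries at least `N`. [folklore] -/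
theorem le_smul_permMonomial_add {n N : ℕ} (π₀ ρ₀ : Equiv.Perm (Fin n)) {e : Fin n × Fin n}
    (he : e ∈ (N • (permMonomial π₀ + permMonomial ρ₀)).support) :
    N ≤ (N • (permMonomial π₀ + permMonomial ρ₀)) e := by
  obtain ⟨r, c⟩ := e
  have hpos : (N • (permMonomial π₀ + permMonomial ρ₀)) (r, c) ≠ 0 := Finsupp.mem_support_iff.1 he
  simp only [Finsupp.smul_apply, Finsupp.add_apply, smul_eq_mul, permMonomial_apply] at hpos ⊢
  have h1 : 1 ≤ (if π₀ c = r then 1 else 0) + (if ρ₀ c = r then 1 else 0) := by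
    by_contra h0
    push Not at h0
    have : (if π₀ c = r then 1 else 0) + (if ρ₀ c = r then 1 else 0) = 0 := by omega
    exact hpos (by rw [this, mul_zero])
  calc N = N * 1 := (mul_one N).symm
    _ ≤ _ := Nat.mul_le_mul_left N h1

/-- **Two-factor class rung (glue: M + dominant hole rung).**  If `h` is torus-homogeneous with all
entries `≤ N` (`1 ≤ N`) and contains the scaled Hamiltonian 2-factor `N • (μ_π₀ + μ_ρ₀)`
(`π₀⁻¹ρ₀` an `n`-cycle) — e.g. `h = h_der^N`, or any multilinear 2-regular class through a
Hamiltonian cycle — then `L⁺(per_{⌊n/3⌋}) ≤ ((n+2)(L⁺(per_n · h)+3))^k`; no hypothesis on the other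
monomials of `h` is needed (compare stub I). [folklore] -/
theorem stub_twoFactorClassRung :
    ∃ k : ℕ, ∀ (n N : ℕ) (h : MvPolynomial (Fin n × Fin n) ℝ≥0) (π₀ ρ₀ : Equiv.Perm (Fin n)),
      1 ≤ N → (π₀⁻¹ * ρ₀).IsCycle → (π₀⁻¹ * ρ₀).support = Finset.univ →
      (∃ τ : (Fin n →₀ ℕ) × (Fin n →₀ ℕ),
        ∀ v ∈ h.support, (Finsupp.mapDomain Prod.fst v, Finsupp.mapDomain Prod.snd v) = τ) →
      (∀ v ∈ h.support, ∀ e, v e ≤ N) →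
      N • (permMonomial π₀ + permMonomial ρ₀) ∈ h.support →
      complexity (perPoly (Fin (n / 3)) ℝ≥0) ≤
        ((n + 2) * (complexity (perPoly (Fin n) ℝ≥0 * h) + 3)) ^ k := by
  classical
  obtain ⟨k, hk⟩ := stub_dominantHoleRung
  refine ⟨k, fun n N h π₀ ρ₀ hN hcyc hsupp hτ hbd hu => ?_⟩
  obtain ⟨er, ec, M₀, her, hec, hblock, hM₀, hinj⟩ := TwoFactorHole.stub_twoFactorHole n π₀ ρ₀ hcyc hsupp
  set u := N • (permMonomial π₀ + permMonomial ρ₀) with hudef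
  have hdom : ∀ v ∈ h.support, ∀ e ∈ u.support, v e ≤ u e :=
    fun v hv e he => (hbd v hv e).trans (le_smul_permMonomial_add π₀ ρ₀ he)
  refine hk n (n / 3) h u er ec M₀ hu hτ hdom her hec (fun a b => ?_) (fun j hj => ?_) hinj
  · simp only [hudef, Finsupp.smul_apply, Finsupp.add_apply, smul_eq_mul, permMonomial_apply,
      if_neg (hblock a b).1, if_neg (hblock a b).2, add_zero, mul_zero]
  · refine ⟨Finsupp.mem_support_iff.2 ?_, (hM₀ j hj).2⟩
    simp only [hudef, Finsupp.smul_apply, Finsupp.add_apply, smul_eq_mul, permMonomial_apply]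
    rcases (hM₀ j hj).1 with h1 | h1
    · rw [if_pos h1.symm]
      intro h0
      rcases mul_eq_zero.1 h0 with h2 | h2 <;> omega
    · rw [if_pos h1.symm]
      intro h0
      rcases mul_eq_zero.1 h0 with h2 | h2 <;> omega

/-- **Two-factor classes are exponentially hard (closed form).**  Under the hypotheses of
`twoFactorClassRung` and `6 ≤ n`: `⌊n/3⌋ (2^{⌊n/3⌋-1} - 1) ≤ 2 ((n+2)(L⁺(per_n · h)+3))^k`
(Jerrum–Snir on `per_{⌊n/3⌋}`). [folklore] -/
theorem stub_twoFactorClassHard :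
    ∃ k : ℕ, ∀ (n N : ℕ) (h : MvPolynomial (Fin n × Fin n) ℝ≥0) (π₀ ρ₀ : Equiv.Perm (Fin n)),
      6 ≤ n → 1 ≤ N → (π₀⁻¹ * ρ₀).IsCycle → (π₀⁻¹ * ρ₀).support = Finset.univ →
      (∃ τ : (Fin n →₀ ℕ) × (Fin n →₀ ℕ),
        ∀ v ∈ h.support, (Finsupp.mapDomain Prod.fst v, Finsupp.mapDomain Prod.snd v) = τ) →
      (∀ v ∈ h.support, ∀ e, v e ≤ N) →
      N • (permMonomial π₀ + permMonomial ρ₀) ∈ h.support →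
      (n / 3) * (2 ^ (n / 3 - 1) - 1) ≤
        2 * ((n + 2) * (complexity (perPoly (Fin n) ℝ≥0 * h) + 3)) ^ k := by
  obtain ⟨k, hk⟩ := stub_twoFactorClassRung
  refine ⟨k, fun n N h π₀ ρ₀ hn hN hcyc hsupp hτ hbd hu => ?_⟩
  have hjs := Summit.ValiantsHypothesis.Theorems.PerDivisionHardNegative.js_le_two_mul_complexity_perPoly
    (n := n / 3) (by omega)
  exact hjs.trans (Nat.mul_le_mul_left 2 (hk n N h π₀ ρ₀ hN hcyc hsupp hτ hbd hu))

/-- **Regular 0/1 classes are exponentially hard (glue: N + dominant hole rung).**  If `h` is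
torus-homogeneous with all entries `≤ N` (`1 ≤ N`) and contains `N • u₀` for EVERY `D`-regular
`0/1` matrix `u₀` (`2 ≤ D`) — e.g. `h = g^N` for the complete `D`-regular multilinear class `g`, the
sibling line's multiplicity test object — then `L⁺(per_m) ≤ ((n+2)(L⁺(per_n · h)+3))^k` whenever
`D + 3m ≤ n`. [folklore] -/
theorem stub_regularClassRung :
    ∃ k : ℕ, ∀ (n D m N : ℕ) (h : MvPolynomial (Fin n × Fin n) ℝ≥0),
      2 ≤ D → D + 3 * m ≤ n → 1 ≤ N →
      (∃ τ : (Fin n →₀ ℕ) × (Fin n →₀ ℕ),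
        ∀ v ∈ h.support, (Finsupp.mapDomain Prod.fst v, Finsupp.mapDomain Prod.snd v) = τ) →
      (∀ v ∈ h.support, ∀ e, v e ≤ N) →
      (∀ u₀ : (Fin n × Fin n) →₀ ℕ, (∀ e, u₀ e ≤ 1) →
        (∀ i, Finsupp.mapDomain Prod.fst u₀ i = D) → (∀ j, Finsupp.mapDomain Prod.snd u₀ j = D) →
        N • u₀ ∈ h.support) →
      complexity (perPoly (Fin m) ℝ≥0) ≤
        ((n + 2) * (complexity (perPoly (Fin n) ℝ≥0 * h) + 3)) ^ k := by
  classical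
  obtain ⟨k, hk⟩ := stub_dominantHoleRung
  refine ⟨k, fun n D m N h hD hn hN hτ hbd hall => ?_⟩
  obtain ⟨u₀, h01, hrow, hcol, er, ec, M₀, her, hec, hblock, hM₀, hinj⟩ :=
    RegularHole.stub_regularHole n D m hD hn
  set u := N • u₀ with hudef
  have hu : u ∈ h.support := hall u₀ h01 hrow hcol
  have hdom : ∀ v ∈ h.support, ∀ e ∈ u.support, v e ≤ u e := by
    intro v hv e he
    have hne : (N • u₀) e ≠ 0 := Finsupp.mem_support_iff.1 he
    have h1 : u₀ e = 1 := by
      have := h01 e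
      have h0 : u₀ e ≠ 0 := fun h0 => hne (by
        simp only [Finsupp.smul_apply, smul_eq_mul, h0, mul_zero])
      omega
    show v e ≤ (N • u₀) e
    simp only [Finsupp.smul_apply, smul_eq_mul, h1, mul_one]
    exact hbd v hv e
  refine hk n m h u er ec M₀ hu hτ hdom her hec (fun a b => ?_) (fun j hj => ?_) hinj
  · simp only [hudef, Finsupp.smul_apply, smul_eq_mul, hblock a b, mul_zero]
  · refine ⟨Finsupp.mem_support_iff.2 ?_, (hM₀ j hj).2⟩
    simp only [hudef, Finsupp.smul_apply, smul_eq_mul, (hM₀ j hj).1, mul_one]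
    omega

end Summit.ValiantsHypothesis.ValiantsHypothesis.Theorems.DivisionGap.PerCofactorDegreeReduction.DominantRungs

end
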